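import Literature.Analysis.FluidPDE.BallMoments
import Mathlib.Analysis.InnerProductSpace.PiL2
import Mathlib.MeasureTheory.Integral.Average
import HarnessLib

/-!
# Second moments of Euclidean balls: averaged and rank-one forms

Topic: Analysis/FluidPDE, companion of `Literature.Analysis.FluidPDE.BallMoments` (which proves
`∫_{B_r} |y|² = (d/(d+2)) |B_1| r^{d+2}`, `∫_{B_r} yᵢ yⱼ = 0` for `i ≠ j`,
`∫_{B_r} yᵢ² = |B_1| r^{d+2}/(d+2)`). Here the same identities are put in the **ball-average**
form in which they enter the masses of Novack's longitudinal kernel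
(Novack 2024, §2 Step 2, (claim): `∫ |B_ℓ|⁻¹ 1_{B_ℓ} T_L = d⁻¹ 1`,
`∫ ζ_ℓ T_T = −(2(d−1)/(d(d+2))) 1`), all **proved**:

* `volumeReal_euclideanBall_eq_pow_mul` — `|B_ℓ| = ℓ^d |B_1|`; `setAverage_ball_norm_sq` —
  `⨍_{B_ℓ} |y|² dy = (d/(d+2)) ℓ²`;
* `setAverage_ball_apply_mul_apply` — the second-moment matrix `⨍_{B_ℓ} yᵢ yⱼ dy = δᵢⱼ ℓ²/(d+2)`;
* `integral_ball_inner_mul_apply`, `setAverage_ball_inner_smul` — the rank-one moment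
  `⨍_{B_ℓ} ⟪y, v⟫ y dy = (ℓ²/(d+2)) v`, and `setAverage_ball_inner_sq` —
  `⨍_{B_ℓ} ⟪y, v⟫² dy = ℓ² |v|²/(d+2)`.

## References

* M. Novack, *Scaling laws and exact results in turbulence*, Nonlinearity 37 (2024) 095002,
  arXiv:2310.01375, §2 Step 2 (the masses of `T_L`, `T_T`, `ζ_ℓ`). [Novack2024]
* G. B. Folland, *Real Analysis*, 2nd ed. (1999), §2.7, Cor. 2.51 and Exercises 2.62–2.63
  (polar coordinates, moments of the ball). [Folland1999]
-/

noncomputable section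

open MeasureTheory MeasureTheory.Measure TopologicalSpace Set Function Filter Metric Module
open scoped InnerProductSpace RealInnerProductSpace ENNReal NNReal

namespace Literature.Analysis.FluidPDE

variable {d : Type*} [Fintype d]

/-! ## Integrability on balls and the volume of `B_ℓ` -/

section Prelim

variable {F : Type*} [NormedAddCommGroup F]

/-- A continuous function on `ℝ^d` is integrable on every ball. [folklore] -/
theorem integrableOn_euclideanBall_of_continuous {f : EuclideanSpace ℝ d → F} (hf : Continuous f)
    (c : EuclideanSpace ℝ d) (ℓ : ℝ) : IntegrableOn f (ball c ℓ) volume :=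
  (hf.continuousOn.integrableOn_compact (isCompact_closedBall c ℓ)).mono_set ball_subset_closedBall

/-- `|B_ℓ| = ℓ^d |B_1|` in `ℝ^d` (real-valued volumes). [folklore] -/
theorem volumeReal_euclideanBall_eq_pow_mul {ℓ : ℝ} (hℓ : 0 < ℓ) :
    volume.real (ball (0 : EuclideanSpace ℝ d) ℓ) =
      ℓ ^ Fintype.card d * volume.real (ball (0 : EuclideanSpace ℝ d) 1) := by
  rw [measureReal_def, measureReal_def, Measure.addHaar_ball_of_pos volume _ hℓ,
    finrank_euclideanSpace, ENNReal.toReal_mul, ENNReal.toReal_ofReal (pow_nonneg hℓ.le _)]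

/-- Balls of positive radius in `ℝ^d` have positive (real) volume. [folklore] -/
theorem volumeReal_euclideanBall_pos (c : EuclideanSpace ℝ d) {ℓ : ℝ} (hℓ : 0 < ℓ) :
    0 < volume.real (ball c ℓ) :=
  ENNReal.toReal_pos (measure_ball_pos volume c hℓ).ne' measure_ball_lt_top.ne

end Prelim

/-! ## Averaged second moments -/

section Averages

/-- **`⨍_{B_ℓ} |y|² dy = (d/(d+2)) ℓ²`** in `ℝ^d`, `d ≥ 1` (the radial second moment
`Literature.Analysis.FluidPDE.integral_ball_norm_sq` divided by `|B_ℓ| = ℓ^d |B_1|`). [cite: Folland1999, Cor. 2.51] -/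
theorem setAverage_ball_norm_sq [Nonempty d] {ℓ : ℝ} (hℓ : 0 < ℓ) :
    ⨍ y in ball (0 : EuclideanSpace ℝ d) ℓ, ‖y‖ ^ 2 =
      (Fintype.card d : ℝ) / ((Fintype.card d : ℝ) + 2) * ℓ ^ 2 := by
  rw [setAverage_eq, integral_ball_norm_sq hℓ.le, smul_eq_mul, volumeReal_euclideanBall_eq_pow_mul hℓ,
    ← measureReal_def, pow_add]
  have hV := (volumeReal_euclideanBall_pos (0 : EuclideanSpace ℝ d) one_pos).ne'
  have hℓn : ℓ ^ Fintype.card d ≠ 0 := pow_ne_zero _ hℓ.ne'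
  field_simp

/-- **The second-moment matrix of the ball**: `⨍_{B_ℓ} yᵢ yⱼ dy = δᵢⱼ ℓ²/(d+2)` in `ℝ^d`,
`d ≥ 1` (`Literature.Analysis.FluidPDE.integral_ball_apply_sq` and
`integral_ball_apply_mul_apply_of_ne`, divided by `|B_ℓ|`). [cite: Folland1999, Exercise 2.63] -/
theorem setAverage_ball_apply_mul_apply [Nonempty d] [DecidableEq d] (i j : d) {ℓ : ℝ}
    (hℓ : 0 < ℓ) :
    ⨍ y in ball (0 : EuclideanSpace ℝ d) ℓ, y i * y j =
      if i = j then ℓ ^ 2 / ((Fintype.card d : ℝ) + 2) else 0 := by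
  rw [setAverage_eq, smul_eq_mul]
  split_ifs with h
  · subst h
    have hsq : ∫ y in ball (0 : EuclideanSpace ℝ d) ℓ, y i * y i =
        ∫ y in ball (0 : EuclideanSpace ℝ d) ℓ, y i ^ 2 :=
      integral_congr_ae (ae_of_all _ fun y => (sq (y i)).symm)
    rw [hsq, integral_ball_apply_sq i hℓ.le, volumeReal_euclideanBall_eq_pow_mul hℓ, ← measureReal_def,
      pow_add]
    have hV := (volumeReal_euclideanBall_pos (0 : EuclideanSpace ℝ d) one_pos).ne'
    have hℓn : ℓ ^ Fintype.card d ≠ 0 := pow_ne_zero _ hℓ.ne'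
    field_simp
  · rw [integral_ball_apply_mul_apply_of_ne h, mul_zero]

end Averages

/-! ## The rank-one moment `⨍ ⟪y, v⟫ y` -/

section RankOne

/-- Coordinates of the real inner product on `ℝ^d`: `⟪y, v⟫ = ∑ⱼ yⱼ vⱼ`. [folklore] -/
theorem real_inner_euclidean_eq_sum (y v : EuclideanSpace ℝ d) : ⟪y, v⟫ = ∑ j, y j * v j := by
  rw [PiLp.inner_apply]
  exact Finset.sum_congr rfl fun j _ => by simp [mul_comm]

/-- `⨍_{B_ℓ} ⟪y, v⟫ yₖ dy = vₖ ℓ²/(d+2)` (only the diagonal moment survives). [folklore] -/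
theorem setAverage_ball_inner_mul_apply [Nonempty d] (v : EuclideanSpace ℝ d) (k : d) {ℓ : ℝ}
    (hℓ : 0 < ℓ) :
    ⨍ y in ball (0 : EuclideanSpace ℝ d) ℓ, ⟪y, v⟫ * y k =
      ℓ ^ 2 / ((Fintype.card d : ℝ) + 2) * v k := by
  classical
  have hpt : ∀ y : EuclideanSpace ℝ d, ⟪y, v⟫ * y k = ∑ j, v j * (y j * y k) := fun y => by
    rw [real_inner_euclidean_eq_sum, Finset.sum_mul]
    exact Finset.sum_congr rfl fun j _ => by ring
  simp_rw [hpt]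
  have hint : ∀ j ∈ (Finset.univ : Finset d),
      Integrable (fun y : EuclideanSpace ℝ d => v j * (y j * y k)) (volume.restrict (ball 0 ℓ)) :=
    fun j _ => (integrableOn_euclideanBall_of_continuous
      ((PiLp.continuous_apply 2 (fun _ : d => ℝ) j).fun_mul
        (PiLp.continuous_apply 2 (fun _ : d => ℝ) k)) 0 ℓ).integrable.const_mul (v j)
  rw [setAverage_eq, integral_finsetSum _ hint, smul_eq_mul, Finset.mul_sum]
  simp_rw [integral_const_mul]
  have hterm : ∀ j, (volume.real (ball (0 : EuclideanSpace ℝ d) ℓ))⁻¹ *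
      (v j * ∫ y in ball (0 : EuclideanSpace ℝ d) ℓ, y j * y k) =
        v j * ⨍ y in ball (0 : EuclideanSpace ℝ d) ℓ, y j * y k := fun j => by
    rw [setAverage_eq, smul_eq_mul]
    ring
  simp_rw [hterm, setAverage_ball_apply_mul_apply _ k hℓ]
  rw [Finset.sum_eq_single k (fun j _ hjk => by rw [if_neg hjk, mul_zero])
    (fun hk => absurd (Finset.mem_univ k) hk), if_pos rfl, mul_comm]

/-- **`⨍_{B_ℓ} ⟪y, v⟫ y dy = (ℓ²/(d+2)) v`** in `ℝ^d`, `d ≥ 1` (the vector form of the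
second-moment matrix). [cite: Folland1999, Exercise 2.63] -/
theorem setAverage_ball_inner_smul [Nonempty d] (v : EuclideanSpace ℝ d) {ℓ : ℝ} (hℓ : 0 < ℓ) :
    ⨍ y in ball (0 : EuclideanSpace ℝ d) ℓ, ⟪y, v⟫ • y = (ℓ ^ 2 / ((Fintype.card d : ℝ) + 2)) • v := by
  have hint : Integrable (fun y : EuclideanSpace ℝ d => ⟪y, v⟫ • y)
      (volume.restrict (ball 0 ℓ)) :=
    integrableOn_euclideanBall_of_continuous ((continuous_id.inner continuous_const).fun_smul continuous_id)
      0 ℓ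
  ext k
  have hk : (⨍ y in ball (0 : EuclideanSpace ℝ d) ℓ, ⟪y, v⟫ • y) k =
      ⨍ y in ball (0 : EuclideanSpace ℝ d) ℓ, ⟪y, v⟫ * y k := by
    rw [setAverage_eq, setAverage_eq, PiLp.smul_apply, smul_eq_mul, smul_eq_mul]
    congr 1
    have h := ((EuclideanSpace.proj (𝕜 := ℝ) k).integral_comp_comm hint).symm
    simpa using h
  rw [hk, setAverage_ball_inner_mul_apply v k hℓ, PiLp.smul_apply, smul_eq_mul]

/-- **`⨍_{B_ℓ} ⟪y, v⟫² dy = ℓ² |v|²/(d+2)`** in `ℝ^d`, `d ≥ 1`. [cite: Folland1999, Exercise 2.63] -/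
theorem setAverage_ball_inner_sq [Nonempty d] (v : EuclideanSpace ℝ d) {ℓ : ℝ} (hℓ : 0 < ℓ) :
    ⨍ y in ball (0 : EuclideanSpace ℝ d) ℓ, ⟪y, v⟫ ^ 2 =
      ℓ ^ 2 / ((Fintype.card d : ℝ) + 2) * ‖v‖ ^ 2 := by
  classical
  have hpt : ∀ y : EuclideanSpace ℝ d, ⟪y, v⟫ ^ 2 = ∑ k, v k * (⟪y, v⟫ * y k) := fun y => by
    rw [sq]
    conv_lhs => arg 2; rw [real_inner_euclidean_eq_sum y v]
    rw [Finset.mul_sum]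
    exact Finset.sum_congr rfl fun k _ => by ring
  simp_rw [hpt]
  have hint : ∀ k ∈ (Finset.univ : Finset d),
      Integrable (fun y : EuclideanSpace ℝ d => v k * (⟪y, v⟫ * y k)) (volume.restrict (ball 0 ℓ)) :=
    fun k _ => (integrableOn_euclideanBall_of_continuous
      ((continuous_id.inner continuous_const).fun_mul (PiLp.continuous_apply 2 (fun _ : d => ℝ) k))
        0 ℓ).integrable.const_mul (v k)
  rw [setAverage_eq, smul_eq_mul, integral_finsetSum _ hint, Finset.mul_sum]
  simp_rw [integral_const_mul]
  have hterm : ∀ k, (volume.real (ball (0 : EuclideanSpace ℝ d) ℓ))⁻¹ *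
      (v k * ∫ y in ball (0 : EuclideanSpace ℝ d) ℓ, ⟪y, v⟫ * y k) =
        v k * ⨍ y in ball (0 : EuclideanSpace ℝ d) ℓ, ⟪y, v⟫ * y k := fun k => by
    rw [setAverage_eq, smul_eq_mul]
    ring
  simp_rw [hterm, setAverage_ball_inner_mul_apply v _ hℓ]
  rw [EuclideanSpace.real_norm_sq_eq, Finset.mul_sum]
  exact Finset.sum_congr rfl fun k _ => by ring

end RankOne

end Literature.Analysis.FluidPDE
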